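import Summits.PneNP.PneNP.Theorems.ExpanderLinearGeneratorsLinearGeneratorModPFregeHardMod2Xor
import Summits.PneNP.PneNP.Theorems.ExpanderLinearGeneratorsLinearGeneratorModPFregeHardCalibration
import Mathlib.Data.Finset.Sort
import HarnessLib

/-!
# `MOD₂` summation, abstract level, IIa: one row — atomic steps and the prefix walk

Support file for item `stmt-PneNP-11444` (`LinearGeneratorModPFregeHard`), calibration line "for
`p = 2` the rung fails".  Setting as in `…Mod2Xor.lean`: `MOD₂` subformulas are atoms
`var (zv c k κ)`, the `MOD₂` axioms are skeleton hypotheses whose negations lie in the context `K`.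
Here the kind `κ` is ONE ROW of the system: its set is `S ⊆ {0,…,n-1}` (the support, so
`Y k κ = x_k` for `k ∈ S` and `⊥` otherwise), its right-hand side is `b`, and `K` contains the
negation `¬C` of every clause `C` of the canonical CNF of the constraint "`Σ_{k ∈ S} x_k = b`"
(one clause per assignment of `S` of the wrong parity).  From these the row fact `Z(b,n,κ)` —
"`MOD_{2,b}(y₀,…,y_{n-1})`" — is derived in `…Mod2Row.lean`; this file holds the first half:

* `sq_atom_step` — one fact, at most two context members, atomic conclusion (`sq_step`);
* `sq_negClause` — `⊢ ¬C, L` when the literals of the clause `C` lie in `L` (bounded ticks);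
* `sq_row_walk` — prefix walk: for every assignment `ρ` of `S ∩ [0,k)` (kept as literal members of
  the sequent), `Z(|ρ⁻¹(1)| mod 2, k, κ)` follows by `k` atomic steps (axiom 3 unfolds one
  argument, which is `⊥`, a false or a true variable).

No definitions are introduced.

Sources: S. Buss et al., Comput. Complexity 6 (1996/97), Def. 1.1 (`MOD_a` axioms); C. Beck,
*Time and Space in Proof Complexity* (2017), Def. 5.6 (the canonical CNF `sumEncoding`);
folklore.
-/

set_option linter.dupNamespace false -- `Summit.PneNP.PneNP.…`: summit = sub-problem (D-0017)

namespace Summit.PneNP.PneNP.Theorems.ModTwo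

open Literature.Computability.Complexity Literature.Computability.Complexity.PropForm
open Literature.Computability.MetaComplexity Literature.Computability.MetaComplexity.DepthFrege
open Literature.Computability.MetaComplexity.TextbookFrege (disjList disjList_nil disjList_cons)
open Literature.Computability.MetaComplexity.KEval (litForm clauseForm clauseForm_cons)

section Row

variable {Q : SPrm} (zv : ZMod 2 → ℕ → ℕ → ℕ) (Y : ℕ → ℕ → PropForm ℕ)
  (H3 : ZMod 2 → ℕ → ℕ → PropForm ℕ) (κ : ℕ) (S : Finset ℕ) (n : ℕ) (K : List (PropForm ℕ))

/-! ### Generic tools: one atomic step, a negated clause -/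

/-- **One atomic step.** From the fact `⊢ z, K'` and at most two context members `C₁, C₂ ∈ K'` of
size `≤ 24` whose falsity together with `z` forces the atom `z'`, infer `⊢ z', K'`
(`sq_step` with one fact). [folklore] -/
theorem sq_atom_step {K' Cs : List (PropForm ℕ)} {z z' t N : ℕ} (hF : Sq Q t (var z :: K'))
    (hCs : ∀ C ∈ Cs, C ∈ K') (hCsl : Cs.length ≤ 2) (hCsz : ∀ C ∈ Cs, C.size ≤ 24)
    (hK' : ∀ A ∈ K', Base Q A) (hQ : 8 ≤ Q.D ∧ 40 ≤ Q.M) (hN : 1200 ≤ N)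
    (hW : K'.length + N + 8 ≤ Q.W)
    (himp : ∀ τ : ℕ → Bool, τ z = true → (∀ C ∈ Cs, C.eval τ = false) → τ z' = true) :
    Sq Q (2 ^ (N + 2) + (t + 2)) (var z' :: K') := by
  have hsum : (Cs.map fun A => A.size ^ 2).sum ≤ 2 * 576 := by
    have h1 : ∀ x ∈ Cs.map (fun A => A.size ^ 2), x ≤ 576 := by
      intro x hx
      obtain ⟨C, hC, rfl⟩ := List.mem_map.1 hx
      have := hCsz C hC
      calc C.size ^ 2 ≤ 24 ^ 2 := Nat.pow_le_pow_left this 2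
        _ = 576 := by norm_num
    have h2 := List.sum_le_card_nsmul _ 576 h1
    simp only [List.length_map, smul_eq_mul] at h2
    calc _ ≤ Cs.length * 576 := h2
      _ ≤ 2 * 576 := Nat.mul_le_mul_right _ hCsl
  have h := sq_step (Q := Q) (K := K') (Fs := [var z]) (t := t) (N := N) (Cs := Cs) (G := var z')
    (by intro F hF; rw [List.mem_singleton] at hF; subst hF; exact hF)
    hCs hK' (base_of_bounds hQ (by simp [altDepth, altDepthAux]) (by simp [size]))
    (by
      intro F hF; rw [List.mem_singleton] at hF; subst hF
      exact base_of_bounds hQ (by simp [altDepth, altDepthAux]) (by simp [size]))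
    (by
      simp only [List.map_cons, List.map_nil, List.map_append, List.sum_append, List.sum_cons,
        List.sum_nil, size]
      omega)
    (by simp only [List.length_singleton]; omega)
    (by
      intro τ hF hC
      have := hF (var z) (by simp)
      simp only [eval] at this ⊢
      exact himp τ this hC)
  exact h.mono (by simp)

/-- `⊢ ¬(l₁ ∨ ⋯ ∨ l_k ∨ ⊥), L` in `2k + 1` ticks whenever every `lᵢ` occurs in `L` (bounded form
of `sq_neg_clauseForm` of `…Calibration.lean`). [Shoenfield 1967, §3.1] [folklore] -/
theorem sq_negClause {L : List (PropForm ℕ)} (hL : ∀ A ∈ L, Base Q A) (hW : L.length + 1 ≤ Q.W) :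
    ∀ c : Clause ℕ, (∀ l ∈ c, litForm l ∈ L) → Base Q (neg (clauseForm c)) →
      Sq Q (2 * c.length + 1) (neg (clauseForm c) :: L)
  | [], _, hb => by
    refine (Sq.negBotMem (L := neg (clauseForm []) :: L) ?_ (by simp; omega)
      (by simp [clauseForm])).mono (by simp)
    intro A hA
    rcases List.mem_cons.1 hA with rfl | hA
    · exact hb
    · exact hL A hA
  | l :: c, hc, hb => by
    rw [clauseForm_cons] at hb ⊢
    have ih := sq_negClause hL hW c (fun l' hl' => hc l' (List.mem_cons_of_mem _ hl'))
      hb.neg_of_negDisj_right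
    have hax : Sq Q 1 (neg (litForm l) :: L) := by
      refine Sq.ax (A := litForm l) ?_ (by simp; omega)
        (List.mem_cons_of_mem _ (hc l List.mem_cons_self)) List.mem_cons_self
      intro A hA
      rcases List.mem_cons.1 hA with rfl | hA
      · exact hb.neg_of_negDisj_left
      · exact hL A hA
    exact (Sq.consNegDisj hax ih hb).mono (by simp; omega)

/-! ### Sorted prefixes of the support -/

/-- The variables of `S` below `k+1`, sorted, for `k ∈ S`: those below `k`, then `k`. [folklore] -/
theorem sort_filter_lt_succ_of_mem {k : ℕ} (hk : k ∈ S) :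
    (S.filter (· < k + 1)).sort (· ≤ ·) = (S.filter (· < k)).sort (· ≤ ·) ++ [k] := by
  refine (Finset.sortedLT_sort _).eq_of_mem_iff ?_ fun a => ?_
  · rw [List.sortedLT_iff_pairwise, List.pairwise_append]
    refine ⟨(Finset.sortedLT_sort _).pairwise, List.pairwise_singleton _ _, ?_⟩
    intro a ha b hb
    rw [List.mem_singleton] at hb
    subst hb
    rw [Finset.mem_sort, Finset.mem_filter] at ha
    exact ha.2
  · simp only [Finset.mem_sort, Finset.mem_filter, List.mem_append, List.mem_singleton]
    constructor
    · rintro ⟨haS, hak⟩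
      rcases Nat.lt_succ_iff_lt_or_eq.1 hak with h | h
      · exact Or.inl ⟨haS, h⟩
      · exact Or.inr h
    · rintro (⟨haS, h⟩ | rfl)
      · exact ⟨haS, Nat.lt_succ_of_lt h⟩
      · exact ⟨hk, Nat.lt_succ_self _⟩

/-- The variables of `S` below `k+1` for `k ∉ S`: those below `k`. [folklore] -/
theorem filter_lt_succ_of_not_mem {k : ℕ} (hk : k ∉ S) : S.filter (· < k + 1) = S.filter (· < k) := by
  ext a
  simp only [Finset.mem_filter, and_congr_right_iff]
  intro ha
  constructor
  · intro h
    rcases Nat.lt_succ_iff_lt_or_eq.1 h with h | rfl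
    · exact h
    · exact absurd ha hk
  · exact Nat.lt_succ_of_lt

/-- Literal formulas are base formulas (re-export for lists of them). [folklore] -/
theorem base_lits (ρ : ℕ → Bool) (L : List ℕ) :
    ∀ A ∈ L.map (fun v => litForm (v, !ρ v)), Base Q A := by
  intro A hA
  obtain ⟨v, -, rfl⟩ := List.mem_map.1 hA
  exact base_litForm Q _

/-! ### The prefix walk -/

/-- **Prefix walk.** For `k ≤ n` and every assignment `ρ`, reading the members
`lit(v, ¬ρ v)` (`v ∈ S`, `v < k`) as "`x_v ≠ ρ v`", the atom `Z(r,k,κ)` with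
`r = |{v ∈ S ∩ [0,k) : ρ v}| mod 2` is derivable in `(2^(N+2)+3)(k+1)` ticks: at `k = 0` it is
axiom 1; from `k` to `k+1` axiom 3 unfolds the argument `y_k`, which is `⊥` (`k ∉ S`) or the
variable `x_k` whose value is read off the literal member. [Buss et al. 1997, Def. 1.1] [folklore] -/
theorem sq_row_walk
    (hH3₀ : ∀ k κ, H3 0 k κ = PropForm.biimp (var (zv 0 (k + 1) κ))
      (disj (conj (var (zv 0 k κ)) (neg (Y k κ))) (conj (var (zv 1 k κ)) (Y k κ))))
    (hH3₁ : ∀ k κ, H3 1 k κ = PropForm.biimp (var (zv 1 (k + 1) κ))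
      (disj (conj (var (zv 1 k κ)) (neg (Y k κ))) (conj (var (zv 0 k κ)) (Y k κ))))
    (hY : ∀ k κ, Y k κ = var k ∨ Y k κ = const false)
    (hYS : ∀ k, Y k κ = if k ∈ S then var k else const false)
    (hKb : ∀ A ∈ K, Base Q A) (hQ : 8 ≤ Q.D ∧ 40 ≤ Q.M)
    (hK3 : ∀ (c : ZMod 2) (k : ℕ), k < n → neg (H3 c k κ) ∈ K)
    (hK1 : neg (var (zv 0 0 κ)) ∈ K)
    {N : ℕ} (hN : 1200 ≤ N) (hW : K.length + S.card + N + 10 ≤ Q.W) :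
    ∀ k, k ≤ n → ∀ ρ : ℕ → Bool,
      Sq Q ((2 ^ (N + 2) + 3) * (k + 1))
        (var (zv ((((S.filter (· < k)).sort (· ≤ ·)).filter fun v => ρ v).length : ZMod 2) k κ) ::
          (((S.filter (· < k)).sort (· ≤ ·)).map (fun v => litForm (v, !ρ v)) ++ K)) := by
  have hc2 : ∀ c : ZMod 2, c = 0 ∨ c = 1 := by decide
  have hH3sz : ∀ (c : ZMod 2) k, (neg (H3 c k κ)).size = 24 := by
    intro c k
    obtain rfl | rfl := hc2 c
    · exact (bounds_H3 zv Y hY (hH3₀ k κ)).2.1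
    · exact (bounds_H3 zv Y hY (hH3₁ k κ)).2.1
  -- length of the literal context
  have hlen : ∀ k (ρ : ℕ → Bool),
      (((S.filter (· < k)).sort (· ≤ ·)).map (fun v => litForm (v, !ρ v))).length ≤ S.card := by
    intro k ρ
    rw [List.length_map, Finset.length_sort]
    exact Finset.card_filter_le _ _
  intro k
  induction k with
  | zero =>
    intro _ ρ
    have h0 : S.filter (· < 0) = ∅ := by ext a; simp
    rw [h0]
    simp only [Finset.sort_empty, List.filter_nil, List.length_nil, Nat.cast_zero, List.map_nil,
      List.nil_append]
    have hax : Sq Q 1 (var (zv 0 0 κ) :: K) := by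
      refine Sq.ax (A := var (zv 0 0 κ)) ?_ ?_ List.mem_cons_self (List.mem_cons_of_mem _ hK1)
      · intro A hA
        rcases List.mem_cons.1 hA with rfl | hA
        · exact base_of_bounds hQ (by simp [altDepth, altDepthAux]) (by simp [size])
        · exact hKb A hA
      · simp only [List.length_cons]; omega
    have h1 : 1 ≤ 2 ^ (N + 2) := Nat.one_le_two_pow
    exact hax.mono (by rw [zero_add, mul_one]; omega)
  | succ k ih =>
    intro hk ρ
    have hk' : k < n := Nat.lt_of_succ_le hk
    have ihk := ih hk'.le ρ
    -- abbreviations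
    set P := (S.filter (· < k)).sort (· ≤ ·) with hP
    set r₀ : ZMod 2 := ((P.filter fun v => ρ v).length : ZMod 2) with hr₀
    have hPl := hlen k ρ
    rw [← hP] at hPl
    by_cases hkS : k ∈ S
    · -- `y_k = x_k`; the prefix grows by `k`
      have hYk : Y k κ = var k := by rw [hYS]; simp [hkS]
      rw [sort_filter_lt_succ_of_mem S hkS, ← hP]
      simp only [List.filter_append, List.map_append, List.map_cons, List.map_nil,
        List.length_append, Nat.cast_add]
      by_cases hρ : ρ k = true
      · -- `x_k` is true: the member is `¬x_k`, the residue moves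
        have hf : ([k].filter fun v => ρ v) = [k] := by simp [hρ]
        rw [hf]
        simp only [List.length_singleton, Nat.cast_one, hρ, Bool.not_true]
        have e1 : litForm (k, false) = neg (var k) := rfl
        rw [e1, List.append_assoc, List.singleton_append]
        -- weaken the fact into the larger context
        have hKb' : ∀ A ∈ P.map (fun v => litForm (v, !ρ v)) ++ (neg (var k) :: K), Base Q A := by
          intro A hA
          simp only [List.mem_append, List.mem_cons] at hA
          rcases hA with hA | rfl | hA
          · exact base_lits ρ _ A hA
          · exact base_litForm Q (k, false)
          · exact hKb A hA
        have h1 : Sq Q ((2 ^ (N + 2) + 3) * (k + 1) + 1)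
            (var (zv r₀ k κ) :: (P.map (fun v => litForm (v, !ρ v)) ++ (neg (var k) :: K))) :=
          ihk.weaken (by intro A hA; simp only [List.mem_cons, List.mem_append] at hA ⊢; tauto)
            (by
              intro A hA
              rcases List.mem_cons.1 hA with rfl | hA
              · exact base_of_bounds hQ (by simp [altDepth, altDepthAux]) (by simp [size])
              · exact hKb' A hA)
            (by simp only [List.length_cons, List.length_append, List.length_map] at hPl ⊢; omega)
        have h2 := sq_atom_step (Q := Q) (N := N) (z' := zv (r₀ + 1) (k + 1) κ)
          (Cs := [neg (H3 (r₀ + 1) k κ), neg (var k)]) h1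
          (by
            intro C hC
            simp only [List.mem_cons, List.not_mem_nil, or_false] at hC
            rcases hC with rfl | rfl
            · exact List.mem_append_right _ (List.mem_cons_of_mem _ (hK3 _ k hk'))
            · exact List.mem_append_right _ List.mem_cons_self)
          (by simp) (by
            intro C hC
            simp only [List.mem_cons, List.not_mem_nil, or_false] at hC
            rcases hC with rfl | rfl
            · rw [hH3sz]
            · simp [size])
          hKb' hQ hN (by simp only [List.length_append, List.length_cons] at hPl ⊢; omega)
          (by
            intro τ hz hC
            have c1 := hC (neg (H3 (r₀ + 1) k κ)) (by simp)
            have c2 := hC (neg (var k)) (by simp)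
            simp only [eval, Bool.not_eq_false'] at c2
            obtain h0 | h1 := hc2 r₀
            · rw [h0] at hz c1 ⊢
              rw [zero_add] at c1 ⊢
              rw [hH3₁, hYk] at c1
              simp only [eval, eval_biimp, Bool.not_eq_false', c2, hz] at c1
              simpa using c1
            · have e : (1 : ZMod 2) + 1 = 0 := by decide
              rw [h1] at hz c1 ⊢
              rw [e] at c1 ⊢
              rw [hH3₀, hYk] at c1
              simp only [eval, eval_biimp, Bool.not_eq_false', c2, hz] at c1
              simpa using c1)
        refine h2.mono ?_
        ring_nf; omega
      · -- `x_k` is false: the member is `x_k`, the residue stays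
        have hρ' : ρ k = false := by simpa using hρ
        have hf : ([k].filter fun v => ρ v) = [] := by simp [hρ']
        rw [hf]
        simp only [List.length_nil, Nat.cast_zero, add_zero, hρ', Bool.not_false]
        have e1 : litForm (k, true) = var k := rfl
        rw [e1, List.append_assoc, List.singleton_append]
        have hKb' : ∀ A ∈ P.map (fun v => litForm (v, !ρ v)) ++ (var k :: K), Base Q A := by
          intro A hA
          simp only [List.mem_append, List.mem_cons] at hA
          rcases hA with hA | rfl | hA
          · exact base_lits ρ _ A hA
          · exact base_litForm Q (k, true)
          · exact hKb A hA
        have h1 : Sq Q ((2 ^ (N + 2) + 3) * (k + 1) + 1)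
            (var (zv r₀ k κ) :: (P.map (fun v => litForm (v, !ρ v)) ++ (var k :: K))) :=
          ihk.weaken (by intro A hA; simp only [List.mem_cons, List.mem_append] at hA ⊢; tauto)
            (by
              intro A hA
              rcases List.mem_cons.1 hA with rfl | hA
              · exact base_of_bounds hQ (by simp [altDepth, altDepthAux]) (by simp [size])
              · exact hKb' A hA)
            (by simp only [List.length_cons, List.length_append, List.length_map] at hPl ⊢; omega)
        have h2 := sq_atom_step (Q := Q) (N := N) (z' := zv r₀ (k + 1) κ)
          (Cs := [neg (H3 r₀ k κ), var k]) h1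
          (by
            intro C hC
            simp only [List.mem_cons, List.not_mem_nil, or_false] at hC
            rcases hC with rfl | rfl
            · exact List.mem_append_right _ (List.mem_cons_of_mem _ (hK3 _ k hk'))
            · exact List.mem_append_right _ List.mem_cons_self)
          (by simp) (by
            intro C hC
            simp only [List.mem_cons, List.not_mem_nil, or_false] at hC
            rcases hC with rfl | rfl
            · rw [hH3sz]
            · simp [size])
          hKb' hQ hN (by simp only [List.length_append, List.length_cons] at hPl ⊢; omega)
          (by
            intro τ hz hC
            have c1 := hC (neg (H3 r₀ k κ)) (by simp)
            have c2 := hC (var k) (by simp)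
            simp only [eval] at c2
            obtain h0 | h1 := hc2 r₀
            · rw [h0] at hz c1 ⊢
              rw [hH3₀, hYk] at c1
              simp only [eval, eval_biimp, Bool.not_eq_false', c2, hz] at c1
              simpa using c1
            · rw [h1] at hz c1 ⊢
              rw [hH3₁, hYk] at c1
              simp only [eval, eval_biimp, Bool.not_eq_false', c2, hz] at c1
              simpa using c1)
        refine h2.mono ?_
        ring_nf; omega
    · -- `y_k = ⊥`; the prefix is unchanged
      have hYk : Y k κ = const false := by rw [hYS]; simp [hkS]
      rw [filter_lt_succ_of_not_mem S hkS, ← hP]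
      have hKb' : ∀ A ∈ P.map (fun v => litForm (v, !ρ v)) ++ K, Base Q A := by
        intro A hA
        rcases List.mem_append.1 hA with hA | hA
        · exact base_lits ρ _ A hA
        · exact hKb A hA
      have h2 := sq_atom_step (Q := Q) (N := N) (z' := zv r₀ (k + 1) κ)
        (Cs := [neg (H3 r₀ k κ)]) ihk
        (by
          intro C hC
          rw [List.mem_singleton] at hC
          subst hC
          exact List.mem_append_right _ (hK3 _ k hk'))
        (by simp) (by
          intro C hC
          rw [List.mem_singleton] at hC
          subst hC
          rw [hH3sz])
        hKb' hQ hN (by simp only [List.length_append] at hPl ⊢; omega)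
        (by
          intro τ hz hC
          have c1 := hC (neg (H3 r₀ k κ)) (by simp)
          obtain h0 | h1 := hc2 r₀
          · rw [h0] at hz c1 ⊢
            rw [hH3₀, hYk] at c1
            simp only [eval, eval_biimp, Bool.not_eq_false', hz] at c1
            simpa using c1
          · rw [h1] at hz c1 ⊢
            rw [hH3₁, hYk] at c1
            simp only [eval, eval_biimp, Bool.not_eq_false', hz] at c1
            simpa using c1)
      refine h2.mono ?_
      ring_nf; omega

end Row

end Summit.PneNP.PneNP.Theorems.ModTwo
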